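import Mathlib
import Summits.ValiantsHypothesis.ValiantsHypothesis.Theorems.RigidityForcesSymmetryRankRigidMinimalReprLaplaceFiveAtMostThreeSlices
import Summits.ValiantsHypothesis.ValiantsHypothesis.Theorems.RigidityForcesSymmetryRankRigidMinimalReprLaplaceFiveThreeSlicesAll

/-!
# A cheap split-rank-one decomposition of `P₅` has at most two slices — modulo the 27 exceptional configurations
# (crux `RankRigidMinimalRepr`, stmt-ValiantsHypothesis-18034; frontier rung `LaplaceOptimalFive`, stmt-24813)

The official-format consequence of `three_slices_three_pairs_all` (`…LaplaceFiveThreeSlicesAll.lean`), in the data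
format of `LaplaceOptimal 5` and CONDITIONAL on the same three hypotheses `hexA`, `hexB`, `hexC` (refutations of the
14 + 6 + 7 sorted three-slices/three-pairs configurations without a dual certificate, in the format of
`three_slices_sorted_{A,B,C}`):

* `three_slices_pairs_le_three_all` — three slices and AT MOST three pair terms (`Np ≤ 3`, padded by zero terms) never
  sum to the `5 × 5` permutation pattern, for every labelling;
* `laplace_five_at_most_two_slices_of` — if split-rank-one terms `u_t(v|_{S_t}) · w_t(v|_{S_tᶜ})` sum to the pattern
  `[v injective]` on `Fin 5 → Fin 5` with total Laplace weight `< 120`, then at most TWO of them are slices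
  (`|S_t| ∈ {1, 4}`): by `laplace_five_at_most_three_slices` (p8 g10) there are at most three, and exactly three slices
  leave weight for at most three pair terms, which the previous statement excludes (normal forms `slice_normal_form`,
  `pair_normal_form` of `…LaplaceFiveAtMostThreeSlices.lean`).

Once `hexA/hexB/hexC` are proved (10 profile types; evidence note of seat val-width-24813-w1 on stmt-24813), both become
unconditional one-liners.  No new definitions.  HONEST FRAMING: a conditional partial result toward the frontier rung
`LaplaceOptimalFive` (stmt-24813: weight `≥ 120`, i.e. no cheap decomposition at all), which stays OPEN; nothing here
bears on `VP ≠ VNP`.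
-/

set_option autoImplicit false

-- the mandated summit-side namespace repeats a component by design (single-problem summit)
set_option linter.dupNamespace false

namespace Summit.ValiantsHypothesis.ValiantsHypothesis.Theorems.RigidityForcesSymmetryRankRigidMinimalRepr

namespace LaplaceFiveSlices

open Finset

section Exceptions

/-! The three hypotheses: refutations of the exceptional sorted configurations (format of `three_slices_sorted_*`). -/
variable
  (hexA : ∀ p0 q0 p1 q1 p2 q2 : Fin 5, (p0, q0, p1, q1, p2, q2) ∈ ([
    (1, 2, 1, 2, 3, 4), (1, 2, 1, 3, 1, 4), (1, 2, 1, 3, 2, 3), (1, 2, 1, 4, 2, 4), (1, 2, 2, 3, 2, 4),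
      (1, 2, 3, 4, 3, 4), (1, 3, 1, 3, 2, 4), (1, 3, 1, 4, 3, 4), (1, 3, 2, 3, 3, 4), (1, 3, 2, 4, 2, 4),
      (1, 4, 1, 4, 2, 3), (1, 4, 2, 3, 2, 3), (1, 4, 2, 4, 3, 4), (2, 3, 2, 4, 3, 4)] :
    List (Fin 5 × Fin 5 × Fin 5 × Fin 5 × Fin 5 × Fin 5)) →
    ∀ (α : Fin 3 → Fin 5 → ℂ) (W : Fin 3 → (Fin 5 → Fin 5) → ℂ),
      (∀ k, ∀ v v' : Fin 5 → Fin 5, (∀ j, j ≠ (![0, 0, 0] : Fin 3 → Fin 5) k → v j = v' j) → W k v = W k v') →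
      ∀ (u w : Fin 3 → (Fin 5 → Fin 5) → ℂ),
      (∀ t, ∀ v v' : Fin 5 → Fin 5,
          v ((![p0, p1, p2] : Fin 3 → Fin 5) t) = v' ((![p0, p1, p2] : Fin 3 → Fin 5) t) →
          v ((![q0, q1, q2] : Fin 3 → Fin 5) t) = v' ((![q0, q1, q2] : Fin 3 → Fin 5) t) → u t v = u t v') →
      (∀ t, ∀ v v' : Fin 5 → Fin 5,
          (∀ j, j ≠ (![p0, p1, p2] : Fin 3 → Fin 5) t → j ≠ (![q0, q1, q2] : Fin 3 → Fin 5) t → v j = v' j) → w t v = w t v') →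
      ¬ ∀ v : Fin 5 → Fin 5, (if Function.Injective v then (1 : ℂ) else 0) =
          (∑ k, α k (v ((![0, 0, 0] : Fin 3 → Fin 5) k)) * W k v) + ∑ t, u t v * w t v)
  (hexB : ∀ p0 q0 p1 q1 p2 q2 : Fin 5, (p0, q0, p1, q1, p2, q2) ∈ ([
    (0, 1, 0, 1, 0, 1), (1, 2, 1, 3, 1, 4), (1, 2, 2, 3, 2, 4), (1, 3, 2, 3, 3, 4), (1, 4, 2, 4, 3, 4),
      (2, 3, 2, 4, 3, 4)] :
    List (Fin 5 × Fin 5 × Fin 5 × Fin 5 × Fin 5 × Fin 5)) →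
    ∀ (α : Fin 3 → Fin 5 → ℂ) (W : Fin 3 → (Fin 5 → Fin 5) → ℂ),
      (∀ k, ∀ v v' : Fin 5 → Fin 5, (∀ j, j ≠ (![0, 0, 1] : Fin 3 → Fin 5) k → v j = v' j) → W k v = W k v') →
      ∀ (u w : Fin 3 → (Fin 5 → Fin 5) → ℂ),
      (∀ t, ∀ v v' : Fin 5 → Fin 5,
          v ((![p0, p1, p2] : Fin 3 → Fin 5) t) = v' ((![p0, p1, p2] : Fin 3 → Fin 5) t) →
          v ((![q0, q1, q2] : Fin 3 → Fin 5) t) = v' ((![q0, q1, q2] : Fin 3 → Fin 5) t) → u t v = u t v') →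
      (∀ t, ∀ v v' : Fin 5 → Fin 5,
          (∀ j, j ≠ (![p0, p1, p2] : Fin 3 → Fin 5) t → j ≠ (![q0, q1, q2] : Fin 3 → Fin 5) t → v j = v' j) → w t v = w t v') →
      ¬ ∀ v : Fin 5 → Fin 5, (if Function.Injective v then (1 : ℂ) else 0) =
          (∑ k, α k (v ((![0, 0, 1] : Fin 3 → Fin 5) k)) * W k v) + ∑ t, u t v * w t v)
  (hexC : ∀ p0 q0 p1 q1 p2 q2 : Fin 5, (p0, q0, p1, q1, p2, q2) ∈ ([
    (0, 1, 0, 1, 0, 1), (0, 1, 0, 2, 1, 2), (0, 1, 0, 2, 3, 4), (0, 1, 1, 2, 3, 4), (0, 2, 0, 2, 0, 2),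
      (0, 2, 1, 2, 3, 4), (1, 2, 1, 2, 1, 2)] :
    List (Fin 5 × Fin 5 × Fin 5 × Fin 5 × Fin 5 × Fin 5)) →
    ∀ (α : Fin 3 → Fin 5 → ℂ) (W : Fin 3 → (Fin 5 → Fin 5) → ℂ),
      (∀ k, ∀ v v' : Fin 5 → Fin 5, (∀ j, j ≠ (![0, 1, 2] : Fin 3 → Fin 5) k → v j = v' j) → W k v = W k v') →
      ∀ (u w : Fin 3 → (Fin 5 → Fin 5) → ℂ),
      (∀ t, ∀ v v' : Fin 5 → Fin 5,
          v ((![p0, p1, p2] : Fin 3 → Fin 5) t) = v' ((![p0, p1, p2] : Fin 3 → Fin 5) t) →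
          v ((![q0, q1, q2] : Fin 3 → Fin 5) t) = v' ((![q0, q1, q2] : Fin 3 → Fin 5) t) → u t v = u t v') →
      (∀ t, ∀ v v' : Fin 5 → Fin 5,
          (∀ j, j ≠ (![p0, p1, p2] : Fin 3 → Fin 5) t → j ≠ (![q0, q1, q2] : Fin 3 → Fin 5) t → v j = v' j) → w t v = w t v') →
      ¬ ∀ v : Fin 5 → Fin 5, (if Function.Injective v then (1 : ℂ) else 0) =
          (∑ k, α k (v ((![0, 1, 2] : Fin 3 → Fin 5) k)) * W k v) + ∑ t, u t v * w t v)

include hexA hexB hexC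

/-- **Three slices and at most three pair terms ≠ P₅, every labelling** (given the exceptional configurations): the
pair terms are indexed by `Fin Np` with `Np ≤ 3` and padded by zero terms to apply `three_slices_three_pairs_all`. -/
theorem three_slices_pairs_le_three_all (i : Fin 3 → Fin 5) (α : Fin 3 → Fin 5 → ℂ)
    (W : Fin 3 → (Fin 5 → Fin 5) → ℂ) (hW : ∀ k, ∀ v v' : Fin 5 → Fin 5, (∀ j, j ≠ i k → v j = v' j) → W k v = W k v')
    {Np : ℕ} (hNp : Np ≤ 3) (p q : Fin Np → Fin 5) (hpq : ∀ t, p t ≠ q t) (u w : Fin Np → (Fin 5 → Fin 5) → ℂ)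
    (hu : ∀ t, ∀ v v' : Fin 5 → Fin 5, v (p t) = v' (p t) → v (q t) = v' (q t) → u t v = u t v')
    (hw : ∀ t, ∀ v v' : Fin 5 → Fin 5, (∀ j, j ≠ p t → j ≠ q t → v j = v' j) → w t v = w t v') :
    ¬ ∀ v : Fin 5 → Fin 5, (if Function.Injective v then (1 : ℂ) else 0) =
        (∑ k, α k (v (i k)) * W k v) + ∑ t, u t v * w t v := by
  intro H
  -- padding: pair terms `t < Np` are the given ones, the others are zero terms on the cut `{0, 1}`
  let P : Fin 3 → Fin 5 := fun t => if h : (t : ℕ) < Np then p ⟨t, h⟩ else 0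
  let Q : Fin 3 → Fin 5 := fun t => if h : (t : ℕ) < Np then q ⟨t, h⟩ else 1
  let U : Fin 3 → (Fin 5 → Fin 5) → ℂ := fun t => if h : (t : ℕ) < Np then u ⟨t, h⟩ else 0
  let V : Fin 3 → (Fin 5 → Fin 5) → ℂ := fun t => if h : (t : ℕ) < Np then w ⟨t, h⟩ else 0
  have hPQ : ∀ t, P t ≠ Q t := by
    intro t
    by_cases h : (t : ℕ) < Np
    · simp only [P, Q, dif_pos h]; exact hpq _
    · simp only [P, Q, dif_neg h]; decide
  have hU : ∀ t, ∀ v v' : Fin 5 → Fin 5, v (P t) = v' (P t) → v (Q t) = v' (Q t) → U t v = U t v' := by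
    intro t v v' h1 h2
    by_cases h : (t : ℕ) < Np
    · simp only [P, Q, U, dif_pos h] at h1 h2 ⊢; exact hu _ v v' h1 h2
    · simp only [U, dif_neg h]; rfl
  have hV : ∀ t, ∀ v v' : Fin 5 → Fin 5, (∀ j, j ≠ P t → j ≠ Q t → v j = v' j) → V t v = V t v' := by
    intro t v v' hvv'
    by_cases h : (t : ℕ) < Np
    · simp only [P, Q, V, dif_pos h] at hvv' ⊢; exact hw _ v v' hvv'
    · simp only [V, dif_neg h]; rfl
  -- the padded sum equals the given one
  have hsum : ∀ v : Fin 5 → Fin 5, ∑ t : Fin 3, U t v * V t v = ∑ t : Fin Np, u t v * w t v := by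
    intro v
    have himg : ∀ t : Fin 3, t ∉ (univ : Finset (Fin Np)).map (Fin.castLEEmb hNp) → U t v * V t v = 0 := by
      intro t ht
      have h : ¬ (t : ℕ) < Np := by
        intro h
        apply ht
        exact mem_map.mpr ⟨⟨t, h⟩, mem_univ _, Fin.ext rfl⟩
      simp only [U, dif_neg h]; simp
    rw [← sum_subset (subset_univ _) (fun t _ ht => himg t ht), sum_map]
    refine sum_congr rfl fun s _ => ?_
    have hs : ((Fin.castLEEmb hNp s : Fin 3) : ℕ) < Np := by simp
    have hs' : (⟨((Fin.castLEEmb hNp s : Fin 3) : ℕ), hs⟩ : Fin Np) = s := Fin.ext (by simp)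
    simp only [U, V, dif_pos hs, hs']
  refine three_slices_three_pairs_all hexA hexB hexC i P Q hPQ α W hW U V hU hV (fun v => ?_)
  rw [H v, hsum v]

/-- **A cheap split-rank-one decomposition of `P₅` has at most two slices** (given the exceptional configurations).
In the data format of `LaplaceOptimal 5`: if the terms sum to the pattern with total Laplace weight `< 120`, then at
most two terms have `|S_t| ∈ {1, 4}`. -/
theorem laplace_five_at_most_two_slices_of {N : ℕ} (T : Finset (Fin N)) (S : Fin N → Finset (Fin 5))
    (u w : Fin N → (Fin 5 → Fin 5) → ℂ)
    (hu : ∀ t, ∀ v v' : Fin 5 → Fin 5, (∀ i ∈ S t, v i = v' i) → u t v = u t v')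
    (hw : ∀ t, ∀ v v' : Fin 5 → Fin 5, (∀ i, i ∉ S t → v i = v' i) → w t v = w t v')
    (hsum : ∀ v : Fin 5 → Fin 5, (∑ t ∈ T, u t v * w t v) = if Function.Injective v then 1 else 0)
    (hlt : ∑ t ∈ T, (S t).card.factorial * (5 - (S t).card).factorial < 120) :
    (T.filter (fun t => (S t).card = 1 ∨ (S t).card = 4)).card ≤ 2 := by
  classical
  have h3 := laplace_five_at_most_three_slices T S u w hu hw hsum hlt
  by_contra hge
  push Not at hge
  -- every term is a slice or a pair term
  have hwt : ∀ t ∈ T, (S t).card.factorial * (5 - (S t).card).factorial < 120 := fun t ht =>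
    lt_of_le_of_lt (single_le_sum (f := fun t => (S t).card.factorial * (5 - (S t).card).factorial)
      (fun _ _ => Nat.zero_le _) ht) hlt
  have hcard5 : ∀ t, (S t).card ≤ 5 := fun t => (card_le_univ _).trans (by simp)
  have htype : ∀ t ∈ T, ((S t).card = 1 ∨ (S t).card = 4) ∨ ((S t).card = 2 ∨ (S t).card = 3) := by
    intro t ht
    have h1 := hwt t ht
    have h2 := hcard5 t
    have h6 : (S t).card = 0 ∨ (S t).card = 1 ∨ (S t).card = 2 ∨ (S t).card = 3 ∨ (S t).card = 4 ∨
        (S t).card = 5 := by omega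
    rcases h6 with hc | hc | hc | hc | hc | hc
    · rw [hc] at h1; exact absurd h1 (by decide)
    · exact Or.inl (Or.inl hc)
    · exact Or.inr (Or.inl hc)
    · exact Or.inr (Or.inr hc)
    · exact Or.inl (Or.inr hc)
    · rw [hc] at h1; exact absurd h1 (by decide)
  set Sl := T.filter (fun t => (S t).card = 1 ∨ (S t).card = 4) with hSl
  set Pr := T.filter (fun t => (S t).card = 2 ∨ (S t).card = 3) with hPr
  have hdisj : Disjoint Sl Pr := by
    rw [hSl, hPr, disjoint_filter]; intro t _ h1 h2; omega
  have hunion : T = Sl ∪ Pr := by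
    ext t
    simp only [hSl, hPr, mem_union, mem_filter]
    constructor
    · intro ht; rcases htype t ht with h | h
      · exact Or.inl ⟨ht, h⟩
      · exact Or.inr ⟨ht, h⟩
    · rintro (⟨ht, -⟩ | ⟨ht, -⟩) <;> exact ht
  -- the weight: 24 |Sl| + 12 |Pr| < 120
  have hweight : 24 * Sl.card + 12 * Pr.card < 120 := by
    have e1 : ∑ t ∈ Sl, (S t).card.factorial * (5 - (S t).card).factorial = 24 * Sl.card := by
      rw [mul_comm, ← smul_eq_mul, ← sum_const]
      refine sum_congr rfl fun t ht => ?_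
      rw [hSl, mem_filter] at ht
      rcases ht.2 with h | h <;> rw [h] <;> decide
    have e2 : ∑ t ∈ Pr, (S t).card.factorial * (5 - (S t).card).factorial = 12 * Pr.card := by
      rw [mul_comm, ← smul_eq_mul, ← sum_const]
      refine sum_congr rfl fun t ht => ?_
      rw [hPr, mem_filter] at ht
      rcases ht.2 with h | h <;> rw [h] <;> decide
    rw [hunion, sum_union hdisj, e1, e2] at hlt
    exact hlt
  have hSl3 : Sl.card = 3 := by omega
  have hPr3 : Pr.card ≤ 3 := by omega
  -- normal forms of the three slices
  have key : ∀ x : Sl, ∃ (s : Fin 5) (α : Fin 5 → ℂ) (W : (Fin 5 → Fin 5) → ℂ),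
      (∀ v v' : Fin 5 → Fin 5, (∀ j, j ≠ s → v j = v' j) → W v = W v') ∧
      ∀ v, u x v * w x v = α (v s) * W v := fun x =>
    slice_normal_form (S x) (u x) (w x) (hu x) (hw x) (by
      have hx : (x : Fin N) ∈ T.filter (fun t => (S t).card = 1 ∨ (S t).card = 4) := x.2
      exact (mem_filter.mp hx).2)
  choose slot α W hWb hterm using key
  have hcardSl : Fintype.card Sl = 3 := by rw [Fintype.card_coe, hSl3]
  let e : Sl ≃ Fin 3 := Fintype.equivFinOfCardEq hcardSl
  -- normal forms of the pair terms
  have keyP : ∀ x : Pr, ∃ (p q : Fin 5) (u' w' : (Fin 5 → Fin 5) → ℂ), p ≠ q ∧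
      (∀ v v' : Fin 5 → Fin 5, v p = v' p → v q = v' q → u' v = u' v') ∧
      (∀ v v' : Fin 5 → Fin 5, (∀ j, j ≠ p → j ≠ q → v j = v' j) → w' v = w' v') ∧
      ∀ v, u x v * w x v = u' v * w' v := fun x =>
    pair_normal_form (S x) (u x) (w x) (hu x) (hw x) (by
      have hx : (x : Fin N) ∈ T.filter (fun t => (S t).card = 2 ∨ (S t).card = 3) := x.2
      exact (mem_filter.mp hx).2)
  choose pp qq u' w' hpq' hu' hw' htermP using keyP
  let e' : Pr ≃ Fin Pr.card := Fintype.equivFinOfCardEq (Fintype.card_coe _)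
  -- the explicit identity
  have H : ∀ v : Fin 5 → Fin 5, (if Function.Injective v then (1 : ℂ) else 0) =
      (∑ k : Fin 3, (fun k => α (e.symm k)) k (v ((fun k => slot (e.symm k)) k)) * (fun k => W (e.symm k)) k v) +
        ∑ t : Fin Pr.card, (fun t => u' (e'.symm t)) t v * (fun t => w' (e'.symm t)) t v := by
    intro v
    rw [← hsum v, hunion, sum_union hdisj]
    congr 1
    · rw [← sum_coe_sort Sl]
      simp only [hterm]
      exact Fintype.sum_equiv e _ _ (fun x => by simp)
    · rw [← sum_coe_sort Pr]
      simp only [htermP]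
      exact Fintype.sum_equiv e' _ _ (fun x => by simp)
  exact three_slices_pairs_le_three_all hexA hexB hexC (fun k => slot (e.symm k)) (fun k => α (e.symm k))
    (fun k => W (e.symm k)) (fun k => hWb (e.symm k)) hPr3 (fun t => pp (e'.symm t)) (fun t => qq (e'.symm t))
    (fun t => hpq' (e'.symm t)) (fun t => u' (e'.symm t)) (fun t => w' (e'.symm t)) (fun t => hu' (e'.symm t))
    (fun t => hw' (e'.symm t)) H

end Exceptions

end LaplaceFiveSlices

end Summit.ValiantsHypothesis.ValiantsHypothesis.Theorems.RigidityForcesSymmetryRankRigidMinimalRepr
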